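import Summits.AnomalousDissipation.AnomalousDissipation.Theses.TaylorCertificates
import Literature.Analysis.FunctionSpaces.TorusFourierModes
import Literature.Analysis.FluidPDE.StatisticalSolutionDirac
import Literature.Analysis.FunctionSpaces.TorusHNegOnePairing
import Literature.Analysis.FunctionSpaces.TorusInverseLaplacian

/-!
# Single real modes, mode sums, their `H`-states; the PAIR FORMULA

Crux `TaylorCertificates.TaylorCertificatePair` (stmt-AnomalousDissipation-13037), negative side
(cdisprove seat `refuter-cdisprove-stmt-AnomalousDissipation-13037-0`): support for the refutation
`Theorems/TaylorCertificatesTaylorCertificatePairRefutation.lean` (CEILING killed by an unresolved beat).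
All statements are written over the tree's objects directly (no new definitions): single real modes
`Torus.realTrigPoly {k} (fun _ => z) = Re (e_k • z)`, mode sums `∑ₘ Torus.realTrigPoly {k m} (fun _ => z m)`,
Fourier coefficients `mFourierCoeff (complexify ∘ ·)`, the transversal products `(fun j => (κ j : ℂ)) ⬝ᵥ z`.

* `exists_state`: a mode sum with transversal polarisations and nonzero frequencies is (a.e.) the representative of a
  state `u ∈ H`; bridges from the certificate's quantities at `u` (norm, pairing, generator pairing, cylindrical
  coordinates; `eGradNormSq` via a.e.-congruence) to integrals against the smooth mode sum.
* `pair_formula`: the inertial pairing of two modes against a smooth field `G` in Fourier variables,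
  `∫ ⟪DG(x)[Re(e_k z)], Re(e_k' z')⟫ = π Im[((k+k')·z) ⟪Ĝ(k+k'), z'⟫] + π Im[conj((k'−k)·z) ⟪Ĝ(k'−k), z'⟫]`
  (product-to-sum for real modes, single-mode Parseval, `𝓕(∂ⱼG) = 2πi kⱼ Ĝ`); `inertial_modes` sums it.
-/

noncomputable section

open MeasureTheory UnitAddTorus Matrix
open scoped InnerProductSpace ENNReal ComplexConjugate

namespace Summit.AnomalousDissipation.AnomalousDissipation.Theorems.TaylorCertificatePair.Negative

open Literature.Analysis.FunctionSpaces Literature.Analysis.FluidPDE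

/-- Unfolding a single real mode: `mode k z x = Re (e_k(x) • z)`. -/
theorem mode_apply (k : Fin 3 → ℤ) (z : (EuclideanSpace ℂ (Fin 3))) (x : (UnitAddTorus (Fin 3))) :
    (Torus.realTrigPoly {k} (fun _ => z)) x = EuclideanSpace.realPart (mFourier k x • z) :=
  Torus.realTrigPoly_singleton_apply k _ x

/-- Single real modes are smooth. -/
theorem isSmooth_mode (k : Fin 3 → ℤ) (z : (EuclideanSpace ℂ (Fin 3))) : Torus.IsSmooth ((Torus.realTrigPoly {k} (fun _ => z))) :=
  Torus.isSmooth_realTrigPoly _ _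

/-- Single real modes are continuous. -/
theorem continuous_mode (k : Fin 3 → ℤ) (z : (EuclideanSpace ℂ (Fin 3))) : Continuous ((Torus.realTrigPoly {k} (fun _ => z))) :=
  (isSmooth_mode k z).continuous

/-- Pairing an integrable field with a mode: `∫ ⟪w, mode k z⟫ = Re ⟪ŵ(k), z⟫`. -/
theorem integral_inner_mode_right {w : (UnitAddTorus (Fin 3)) → (EuclideanSpace ℝ (Fin 3))} (hw : Integrable w volume) (k : Fin 3 → ℤ) (z : (EuclideanSpace ℂ (Fin 3))) :
    ∫ x, ⟪w x, (Torus.realTrigPoly {k} (fun _ => z)) x⟫_ℝ = (⟪mFourierCoeff (EuclideanSpace.complexify ∘ w) k, z⟫_ℂ).re :=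
  Torus.integral_inner_realTrigPoly_singleton hw k _

/-- Pairing a mode with an integrable field: `∫ ⟪mode k z, w⟫ = Re ⟪z, ŵ(k)⟫`. -/
theorem integral_inner_mode_left {w : (UnitAddTorus (Fin 3)) → (EuclideanSpace ℝ (Fin 3))} (hw : Integrable w volume) (k : Fin 3 → ℤ) (z : (EuclideanSpace ℂ (Fin 3))) :
    ∫ x, ⟪(Torus.realTrigPoly {k} (fun _ => z)) x, w x⟫_ℝ = (⟪z, mFourierCoeff (EuclideanSpace.complexify ∘ w) k⟫_ℂ).re := by
  simpa using Torus.integral_inner_realTrigPoly_of_integrable_left {k} (fun _ => z) hw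

/-- Product-to-sum: a coordinate of one mode times another mode is a sum of two modes. -/
theorem coord_smul_mode (k k' : Fin 3 → ℤ) (z z' : (EuclideanSpace ℂ (Fin 3))) (j : Fin 3) (x : (UnitAddTorus (Fin 3))) :
    ((Torus.realTrigPoly {k} (fun _ => z)) x j) • (Torus.realTrigPoly {k'} (fun _ => z')) x =
      (2 : ℝ)⁻¹ • (Torus.realTrigPoly {(k + k')} (fun _ => (z j • z'))) x + (2 : ℝ)⁻¹ • (Torus.realTrigPoly {(k' - k)} (fun _ => ((conj (z j)) • z'))) x := by
  ext i
  simp only [mode_apply, PiLp.smul_apply, PiLp.add_apply, smul_eq_mul,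
    EuclideanSpace.realPart_apply]
  have h1 : mFourier (k + k') x = mFourier k x * mFourier k' x := mFourier_add
  have h2 : mFourier (k' - k) x = conj (mFourier k x) * mFourier k' x := by
    rw [sub_eq_add_neg, add_comm, mFourier_add, mFourier_neg]
  rw [h1, h2]
  simp only [Complex.mul_re, Complex.mul_im, Complex.conj_re, Complex.conj_im]
  ring

/-- `conj (2πi m) = -2πi m` for an integer `m`. -/
theorem conj_two_pi_I_mul (m : ℤ) :
    conj (2 * (Real.pi : ℂ) * Complex.I * (m : ℂ)) = -(2 * (Real.pi : ℂ) * Complex.I * (m : ℂ)) := by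
  apply Complex.ext <;> simp

/-- `½ Re(-2πi S) = π Im S`. -/
theorem half_re_neg_two_pi_I_mul (S : ℂ) :
    (2 : ℝ)⁻¹ * (-(2 * (Real.pi : ℂ) * Complex.I) * S).re = Real.pi * S.im := by
  simp [Complex.mul_re, Complex.mul_im]
  ring

/-- Pairing a partial derivative of a smooth field with a mode. -/
theorem integral_inner_partialDeriv_mode {G : (UnitAddTorus (Fin 3)) → (EuclideanSpace ℝ (Fin 3))} (hG : Torus.IsSmooth G) (j : Fin 3)
    (κ : Fin 3 → ℤ) (y : (EuclideanSpace ℂ (Fin 3))) :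
    ∫ x, ⟪Torus.partialDeriv j G x, (Torus.realTrigPoly {κ} (fun _ => y)) x⟫_ℝ =
      (conj (2 * (Real.pi : ℂ) * Complex.I * (κ j : ℂ)) * ⟪(mFourierCoeff (EuclideanSpace.complexify ∘ G) κ), y⟫_ℂ).re := by
  rw [integral_inner_mode_right ((hG.partialDeriv j).integrable),
    Torus.mFourierCoeff_complexify_partialDeriv hG j κ, inner_smul_left]

/-- The pairing of a partial derivative of a smooth field with a mode is integrable. -/
theorem integrable_inner_partialDeriv_mode {G : (UnitAddTorus (Fin 3)) → (EuclideanSpace ℝ (Fin 3))} (hG : Torus.IsSmooth G) (j : Fin 3)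
    (κ : Fin 3 → ℤ) (y : (EuclideanSpace ℂ (Fin 3))) :
    Integrable (fun x => ⟪Torus.partialDeriv j G x, (Torus.realTrigPoly {κ} (fun _ => y)) x⟫_ℝ) volume :=
  ((hG.partialDeriv j).continuous.inner (continuous_mode κ y)).integrable_unitAddTorus

/-- **Pair formula.** The inertial pairing of two single modes against a smooth field `G`:
`∫ ⟪DG(x)[mode k z (x)], mode k' z' (x)⟫ = π Im[((k+k')·z) ⟪Ĝ(k+k'), z'⟫] + π Im[conj((k'-k)·z) ⟪Ĝ(k'-k), z'⟫]`. -/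
theorem pair_formula {G : (UnitAddTorus (Fin 3)) → (EuclideanSpace ℝ (Fin 3))} (hG : Torus.IsSmooth G) (k k' : Fin 3 → ℤ) (z z' : (EuclideanSpace ℂ (Fin 3))) :
    ∫ x, ⟪Torus.fderiv G x ((Torus.realTrigPoly {k} (fun _ => z)) x), (Torus.realTrigPoly {k'} (fun _ => z')) x⟫_ℝ =
      Real.pi * (((fun j => (((k + k')) j : ℂ)) ⬝ᵥ (WithLp.ofLp (z))) * ⟪(mFourierCoeff (EuclideanSpace.complexify ∘ G) (k + k')), z'⟫_ℂ).im +
        Real.pi * (conj (((fun j => (((k' - k)) j : ℂ)) ⬝ᵥ (WithLp.ofLp (z)))) * ⟪(mFourierCoeff (EuclideanSpace.complexify ∘ G) (k' - k)), z'⟫_ℂ).im := by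
  have hG1 : Torus.IsContDiff 1 G := hG.isContDiff (by simp)
  have hpt : ∀ x, ⟪Torus.fderiv G x ((Torus.realTrigPoly {k} (fun _ => z)) x), (Torus.realTrigPoly {k'} (fun _ => z')) x⟫_ℝ =
      ∑ j, ((2 : ℝ)⁻¹ * ⟪Torus.partialDeriv j G x, (Torus.realTrigPoly {(k + k')} (fun _ => (z j • z'))) x⟫_ℝ +
        (2 : ℝ)⁻¹ * ⟪Torus.partialDeriv j G x, (Torus.realTrigPoly {(k' - k)} (fun _ => (conj (z j) • z'))) x⟫_ℝ) := by
    intro x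
    rw [Torus.fderiv_apply_eq_sum_partialDeriv hG1 x, sum_inner]
    refine Finset.sum_congr rfl fun j _ => ?_
    rw [real_inner_smul_left, ← real_inner_smul_right, coord_smul_mode, inner_add_right,
      real_inner_smul_right, real_inner_smul_right]
  simp_rw [hpt]
  rw [integral_finsetSum _
    (f := fun j x => (2 : ℝ)⁻¹ * ⟪Torus.partialDeriv j G x, (Torus.realTrigPoly {(k + k')} (fun _ => (z j • z'))) x⟫_ℝ +
        (2 : ℝ)⁻¹ * ⟪Torus.partialDeriv j G x, (Torus.realTrigPoly {(k' - k)} (fun _ => (conj (z j) • z'))) x⟫_ℝ)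
    (fun j _ => ((integrable_inner_partialDeriv_mode hG j _ _).const_mul _).add
      ((integrable_inner_partialDeriv_mode hG j _ _).const_mul _))]
  have hj : ∀ j : Fin 3,
      ∫ x, ((2 : ℝ)⁻¹ * ⟪Torus.partialDeriv j G x, (Torus.realTrigPoly {(k + k')} (fun _ => (z j • z'))) x⟫_ℝ +
        (2 : ℝ)⁻¹ * ⟪Torus.partialDeriv j G x, (Torus.realTrigPoly {(k' - k)} (fun _ => (conj (z j) • z'))) x⟫_ℝ) =
      (2 : ℝ)⁻¹ * (-(2 * (Real.pi : ℂ) * Complex.I) *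
          (((k + k') j : ℂ) * z j * ⟪(mFourierCoeff (EuclideanSpace.complexify ∘ G) (k + k')), z'⟫_ℂ)).re +
        (2 : ℝ)⁻¹ * (-(2 * (Real.pi : ℂ) * Complex.I) *
          (((k' - k) j : ℂ) * conj (z j) * ⟪(mFourierCoeff (EuclideanSpace.complexify ∘ G) (k' - k)), z'⟫_ℂ)).re := by
    intro j
    rw [integral_add ((integrable_inner_partialDeriv_mode hG j _ _).const_mul _)
      ((integrable_inner_partialDeriv_mode hG j _ _).const_mul _),
      integral_const_mul, integral_const_mul, integral_inner_partialDeriv_mode hG,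
      integral_inner_partialDeriv_mode hG, inner_smul_right, inner_smul_right,
      conj_two_pi_I_mul, conj_two_pi_I_mul]
    congr 3 <;> ring
  simp_rw [hj]
  rw [Finset.sum_add_distrib, ← Finset.mul_sum, ← Finset.mul_sum, ← Complex.re_sum,
    ← Complex.re_sum, ← Finset.mul_sum, ← Finset.mul_sum, half_re_neg_two_pi_I_mul,
    half_re_neg_two_pi_I_mul]
  congr 2
  · rw [dotProduct, Finset.sum_mul]
  · rw [dotProduct, map_sum, Finset.sum_mul]
    refine congrArg Complex.im (Finset.sum_congr rfl fun j _ => ?_)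
    simp [map_mul]

/-! ## Finite sums of modes and their `H`-classes -/

/-- A single mode with nonzero frequency has zero mean. -/
theorem hasZeroMean_mode {k : Fin 3 → ℤ} (hk : k ≠ 0) (z : (EuclideanSpace ℂ (Fin 3))) : Torus.HasZeroMean ((Torus.realTrigPoly {k} (fun _ => z))) := by
  unfold Torus.HasZeroMean
  have h1 : (fun x => (Torus.realTrigPoly {k} (fun _ => z)) x) = fun x => EuclideanSpace.realPart (mFourier k x • z) :=
    funext fun x => mode_apply k z x
  have hint : Integrable (fun x : (UnitAddTorus (Fin 3)) => mFourier k x • z) volume :=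
    ((mFourier k).continuous.smul continuous_const).integrable_unitAddTorus
  rw [h1, ContinuousLinearMap.integral_comp_comm _ hint, integral_smul_const,
    Torus.integral_mFourier, if_neg hk, zero_smul, map_zero]

variable {n : ℕ}

/-- Unfolding a mode sum. -/
theorem modes_apply (k : Fin n → (Fin 3 → ℤ)) (z : Fin n → (EuclideanSpace ℂ (Fin 3))) (x : (UnitAddTorus (Fin 3))) :
    (∑ mm, Torus.realTrigPoly {k mm} (fun _ => z mm)) x = ∑ m, (Torus.realTrigPoly {(k m)} (fun _ => (z m))) x :=
  Finset.sum_apply _ _ _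

/-- A mode sum as a pointwise linear combination. -/
theorem modes_eq_fun (k : Fin n → (Fin 3 → ℤ)) (z : Fin n → (EuclideanSpace ℂ (Fin 3))) :
    (∑ mm, Torus.realTrigPoly {k mm} (fun _ => z mm)) = fun y => ∑ m ∈ Finset.univ, (1 : ℝ) • (Torus.realTrigPoly {(k m)} (fun _ => (z m))) y := by
  funext y
  rw [modes_apply]
  simp

/-- Mode sums are smooth. -/
theorem isSmooth_modes (k : Fin n → (Fin 3 → ℤ)) (z : Fin n → (EuclideanSpace ℂ (Fin 3))) : Torus.IsSmooth ((∑ mm, Torus.realTrigPoly {k mm} (fun _ => z mm))) := by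
  rw [modes_eq_fun]
  exact Torus.IsSmooth.sum_smul _ _ fun m => isSmooth_mode (k m) (z m)

/-- Mode sums are continuous. -/
theorem continuous_modes (k : Fin n → (Fin 3 → ℤ)) (z : Fin n → (EuclideanSpace ℂ (Fin 3))) : Continuous ((∑ mm, Torus.realTrigPoly {k mm} (fun _ => z mm))) :=
  (isSmooth_modes k z).continuous

/-- Mode sums are in `L²`. -/
theorem memLp_modes (k : Fin n → (Fin 3 → ℤ)) (z : Fin n → (EuclideanSpace ℂ (Fin 3))) : MemLp ((∑ mm, Torus.realTrigPoly {k mm} (fun _ => z mm))) 2 volume :=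
  (isSmooth_modes k z).memLp 2

/-- Mode sums with transversal polarisations are divergence free. -/
theorem isDivFree_modes (k : Fin n → (Fin 3 → ℤ)) (z : Fin n → (EuclideanSpace ℂ (Fin 3))) (hz : ∀ m, ((fun j => (((k m)) j : ℂ)) ⬝ᵥ (WithLp.ofLp ((z m)))) = 0) :
    Torus.IsDivFree ((∑ mm, Torus.realTrigPoly {k mm} (fun _ => z mm))) := by
  rw [modes_eq_fun]
  exact Torus.IsDivFree.sum_smul _ _ (fun m => isSmooth_mode (k m) (z m))
    fun m => Torus.isDivFree_realTrigPoly_singleton (hz m)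

/-- Mode sums with nonzero frequencies have zero mean. -/
theorem hasZeroMean_modes (k : Fin n → (Fin 3 → ℤ)) (z : Fin n → (EuclideanSpace ℂ (Fin 3))) (hk : ∀ m, k m ≠ 0) :
    Torus.HasZeroMean ((∑ mm, Torus.realTrigPoly {k mm} (fun _ => z mm))) := by
  rw [modes_eq_fun]
  exact Torus.HasZeroMean.sum_smul _ _ (fun m => (isSmooth_mode (k m) (z m)).integrable)
    fun m => hasZeroMean_mode (hk m) (z m)

/-- **States.** A finite sum of transversal modes with nonzero frequencies is (a.e.) the representative
of an element of the energy space `H`. -/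
theorem exists_state (k : Fin n → (Fin 3 → ℤ)) (z : Fin n → (EuclideanSpace ℂ (Fin 3))) (hk : ∀ m, k m ≠ 0)
    (hz : ∀ m, ((fun j => (((k m)) j : ℂ)) ⬝ᵥ (WithLp.ofLp ((z m)))) = 0) :
    ∃ u : (Torus.energySpace (Fin 3)), (((u : (Torus.energySpace (Fin 3))) : (Lp (EuclideanSpace ℝ (Fin 3)) 2 (volume : Measure (UnitAddTorus (Fin 3))))) : (UnitAddTorus (Fin 3)) → (EuclideanSpace ℝ (Fin 3))) =ᵐ[volume] (∑ mm, Torus.realTrigPoly {k mm} (fun _ => z mm)) :=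
  ⟨⟨(memLp_modes k z).toLp ((∑ mm, Torus.realTrigPoly {k mm} (fun _ => z mm))),
    Torus.smoothSolenoidal_subset_energySpace ⟨(∑ mm, Torus.realTrigPoly {k mm} (fun _ => z mm)), isSmooth_modes k z,
      isDivFree_modes k z hz, hasZeroMean_modes k z hk, MemLp.coeFn_toLp _⟩⟩,
    (memLp_modes k z).coeFn_toLp⟩

variable {k : Fin n → (Fin 3 → ℤ)} {z : Fin n → (EuclideanSpace ℂ (Fin 3))}

/-- The squared `H`-norm of a state is the energy of its representative. -/
theorem norm_sq_of_ae {u : (Torus.energySpace (Fin 3))} {w : (UnitAddTorus (Fin 3)) → (EuclideanSpace ℝ (Fin 3))} (hu : (((u : (Torus.energySpace (Fin 3))) : (Lp (EuclideanSpace ℝ (Fin 3)) 2 (volume : Measure (UnitAddTorus (Fin 3))))) : (UnitAddTorus (Fin 3)) → (EuclideanSpace ℝ (Fin 3))) =ᵐ[volume] w) :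
    ‖u‖ ^ 2 = ∫ x, ‖w x‖ ^ 2 := by
  rw [Submodule.coe_norm, ← real_inner_self_eq_norm_sq, MeasureTheory.L2.inner_def]
  refine integral_congr_ae ?_
  filter_upwards [hu] with x hx
  rw [hx, real_inner_self_eq_norm_sq]

/-- a.e.-congruence of the spectral gradient norm (local copy of `eGradNormSq_congr_ae`). -/
theorem eGradNormSq_congr_ae' {v w : (UnitAddTorus (Fin 3)) → (EuclideanSpace ℝ (Fin 3))} (h : v =ᵐ[volume] w) :
    Torus.eGradNormSq v = Torus.eGradNormSq w := by
  unfold Torus.eGradNormSq Torus.eHomSobolevSeminorm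
  have hc : (EuclideanSpace.complexify ∘ v) =ᵐ[volume] (EuclideanSpace.complexify ∘ w) := by
    filter_upwards [h] with x hx
    simp only [Function.comp_apply, hx]
  simp_rw [Torus.mFourierCoeff_congr_ae hc]

/-- The `L²` pairing of a state with a field is the integral against its representative. -/
theorem pairing_of_ae {u : (Torus.energySpace (Fin 3))} {w : (UnitAddTorus (Fin 3)) → (EuclideanSpace ℝ (Fin 3))} (hu : (((u : (Torus.energySpace (Fin 3))) : (Lp (EuclideanSpace ℝ (Fin 3)) 2 (volume : Measure (UnitAddTorus (Fin 3))))) : (UnitAddTorus (Fin 3)) → (EuclideanSpace ℝ (Fin 3))) =ᵐ[volume] w)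
    (f : (UnitAddTorus (Fin 3)) → (EuclideanSpace ℝ (Fin 3))) : Torus.pairing ((u : (Torus.energySpace (Fin 3))) : (Lp (EuclideanSpace ℝ (Fin 3)) 2 (volume : Measure (UnitAddTorus (Fin 3))))) f = ∫ x, ⟪w x, f x⟫_ℝ := by
  unfold Torus.pairing
  refine integral_congr_ae ?_
  filter_upwards [hu] with x hx
  rw [hx]

/-- The Navier–Stokes generator pairing at a state, written on its representative. -/
theorem nsGeneratorPairing_of_ae {u : (Torus.energySpace (Fin 3))} {w : (UnitAddTorus (Fin 3)) → (EuclideanSpace ℝ (Fin 3))} (hu : (((u : (Torus.energySpace (Fin 3))) : (Lp (EuclideanSpace ℝ (Fin 3)) 2 (volume : Measure (UnitAddTorus (Fin 3))))) : (UnitAddTorus (Fin 3)) → (EuclideanSpace ℝ (Fin 3))) =ᵐ[volume] w)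
    (ν : ℝ) (f W : (UnitAddTorus (Fin 3)) → (EuclideanSpace ℝ (Fin 3))) :
    Torus.nsGeneratorPairing ν f u W =
      (∫ x, ⟪f x, W x⟫_ℝ) + ν * (∫ x, ⟪w x, Torus.laplacian W x⟫_ℝ) +
        ∫ x, ⟪Torus.fderiv W x (w x), w x⟫_ℝ := by
  have h1 : (∫ x, ⟪(((u : (Torus.energySpace (Fin 3))) : (Lp (EuclideanSpace ℝ (Fin 3)) 2 (volume : Measure (UnitAddTorus (Fin 3))))) : (UnitAddTorus (Fin 3)) → (EuclideanSpace ℝ (Fin 3))) x, Torus.laplacian W x⟫_ℝ) =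
      ∫ x, ⟪w x, Torus.laplacian W x⟫_ℝ := by
    refine integral_congr_ae ?_
    filter_upwards [hu] with x hx
    rw [hx]
  have h2 : (∫ x, ⟪Torus.fderiv W x ((((u : (Torus.energySpace (Fin 3))) : (Lp (EuclideanSpace ℝ (Fin 3)) 2 (volume : Measure (UnitAddTorus (Fin 3))))) : (UnitAddTorus (Fin 3)) → (EuclideanSpace ℝ (Fin 3))) x), (((u : (Torus.energySpace (Fin 3))) : (Lp (EuclideanSpace ℝ (Fin 3)) 2 (volume : Measure (UnitAddTorus (Fin 3))))) : (UnitAddTorus (Fin 3)) → (EuclideanSpace ℝ (Fin 3))) x⟫_ℝ) =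
      ∫ x, ⟪Torus.fderiv W x (w x), w x⟫_ℝ := by
    refine integral_congr_ae ?_
    filter_upwards [hu] with x hx
    rw [hx]
  unfold Torus.nsGeneratorPairing Torus.inertialPairing
  rw [h1, h2]

/-- The cylindrical coordinates of a state are integrals against its representative. -/
theorem coords_of_ae {u : (Torus.energySpace (Fin 3))} {w : (UnitAddTorus (Fin 3)) → (EuclideanSpace ℝ (Fin 3))} (hu : (((u : (Torus.energySpace (Fin 3))) : (Lp (EuclideanSpace ℝ (Fin 3)) 2 (volume : Measure (UnitAddTorus (Fin 3))))) : (UnitAddTorus (Fin 3)) → (EuclideanSpace ℝ (Fin 3))) =ᵐ[volume] w)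
    (Φ : Torus.CylindricalTest (Fin 3)) (i : Fin Φ.m) :
    Φ.coords u i = ∫ x, ⟪w x, Φ.g i x⟫_ℝ := by
  change Torus.pairing ((u : (Torus.energySpace (Fin 3))) : (Lp (EuclideanSpace ℝ (Fin 3)) 2 (volume : Measure (UnitAddTorus (Fin 3))))) (Φ.g i) = _
  exact pairing_of_ae hu _

/-! ### Pairings of mode sums -/

/-- Pairing a mode sum with an integrable field, in Fourier variables. -/
theorem integral_inner_modes_left {w : (UnitAddTorus (Fin 3)) → (EuclideanSpace ℝ (Fin 3))} (hw : Integrable w volume) :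
    ∫ x, ⟪(∑ mm, Torus.realTrigPoly {k mm} (fun _ => z mm)) x, w x⟫_ℝ = ∑ m, (⟪z m, (mFourierCoeff (EuclideanSpace.complexify ∘ w) (k m))⟫_ℂ).re := by
  simp_rw [modes_apply, sum_inner]
  rw [integral_finsetSum _ (f := fun m x => ⟪(Torus.realTrigPoly {(k m)} (fun _ => (z m))) x, w x⟫_ℝ) (fun m _ =>
    (Torus.integrable_inner_of_continuous hw (continuous_mode (k m) (z m))).congr
      (ae_of_all _ fun x => real_inner_comm _ _))]
  exact Finset.sum_congr rfl fun m _ => integral_inner_mode_left hw (k m) (z m)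

/-- The inertial pairing of a mode sum against a smooth field is the double sum of pair formulas. -/
theorem inertial_modes {G : (UnitAddTorus (Fin 3)) → (EuclideanSpace ℝ (Fin 3))} (hG : Torus.IsSmooth G) :
    ∫ x, ⟪Torus.fderiv G x ((∑ mm, Torus.realTrigPoly {k mm} (fun _ => z mm)) x), (∑ mm, Torus.realTrigPoly {k mm} (fun _ => z mm)) x⟫_ℝ =
      ∑ m, ∑ m', (Real.pi * (((fun j => (((k m + k m')) j : ℂ)) ⬝ᵥ (WithLp.ofLp ((z m)))) * ⟪(mFourierCoeff (EuclideanSpace.complexify ∘ G) (k m + k m')), z m'⟫_ℂ).im +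
        Real.pi * (conj (((fun j => (((k m' - k m)) j : ℂ)) ⬝ᵥ (WithLp.ofLp ((z m))))) * ⟪(mFourierCoeff (EuclideanSpace.complexify ∘ G) (k m' - k m)), z m'⟫_ℂ).im) := by
  have hpt : ∀ x, ⟪Torus.fderiv G x ((∑ mm, Torus.realTrigPoly {k mm} (fun _ => z mm)) x), (∑ mm, Torus.realTrigPoly {k mm} (fun _ => z mm)) x⟫_ℝ =
      ∑ m, ∑ m', ⟪Torus.fderiv G x ((Torus.realTrigPoly {(k m)} (fun _ => (z m))) x), (Torus.realTrigPoly {(k m')} (fun _ => (z m'))) x⟫_ℝ := by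
    intro x
    rw [modes_apply, map_sum, sum_inner]
    exact Finset.sum_congr rfl fun m _ => inner_sum _ _ _
  simp_rw [hpt]
  have hint : ∀ m m', Integrable
      (fun x => ⟪Torus.fderiv G x ((Torus.realTrigPoly {(k m)} (fun _ => (z m))) x), (Torus.realTrigPoly {(k m')} (fun _ => (z m'))) x⟫_ℝ) volume := by
    intro m m'
    refine Continuous.integrable_unitAddTorus ?_
    refine Continuous.inner ?_ (continuous_mode _ _)
    have hG1 : Torus.IsContDiff 1 G := hG.isContDiff (by simp)
    have h : (fun x => Torus.fderiv G x ((Torus.realTrigPoly {(k m)} (fun _ => (z m))) x)) =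
        fun x => ∑ j, ((Torus.realTrigPoly {(k m)} (fun _ => (z m))) x j) • Torus.partialDeriv j G x :=
      funext fun x => Torus.fderiv_apply_eq_sum_partialDeriv hG1 x _
    rw [h]
    refine continuous_finsetSum _ fun j _ => ?_
    exact ((EuclideanSpace.proj (𝕜 := ℝ) j).continuous.comp (continuous_mode _ _)).smul
      (hG.partialDeriv j).continuous
  rw [integral_finsetSum _ (f := fun m x => ∑ m', ⟪Torus.fderiv G x ((Torus.realTrigPoly {(k m)} (fun _ => (z m))) x),
    (Torus.realTrigPoly {(k m')} (fun _ => (z m'))) x⟫_ℝ) (fun m _ => integrable_finsetSum _ fun m' _ => hint m m')]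
  refine Finset.sum_congr rfl fun m _ => ?_
  rw [integral_finsetSum _ (f := fun m' x => ⟪Torus.fderiv G x ((Torus.realTrigPoly {(k m)} (fun _ => (z m))) x),
    (Torus.realTrigPoly {(k m')} (fun _ => (z m'))) x⟫_ℝ) (fun m' _ => hint m m')]
  exact Finset.sum_congr rfl fun m' _ => pair_formula hG _ _ _ _

end Summit.AnomalousDissipation.AnomalousDissipation.Theorems.TaylorCertificatePair.Negative
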